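import Summits.BirchSwinnertonDyer.Rank1Residual.Additive.PadicLogImage
import HarnessLib

/-!
# The limit logarithm IS the formal-group logarithm: `L(P) = log_W(z(P))` on `E⁽²⁾(ℚ_p)`, so
# `padicLog = log_ω` (cell `b2b-bsdres`, team n1011, row T-R1-24; seat n1011-p05 gen 3)

HONEST FRAMING (cell `b2b-bsdres`, run/shared/lean/b2b/bsd-rank1-residual/, verbatim in every
file): the goal of the cell is to DELETE the COMBINATION-SHAPED residual classes of the
Birch–Swinnerton-Dyer formula for ALL analytic-rank `≤ 1` elliptic curves over `ℚ` — "full BSD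
formula for every rank `≤ 1` curve in class `C`" assembled STRICTLY from published theorems — so
that the rank-`≤ 1` remainder becomes exactly the CONSTRUCTION-SHAPED classes, which are TYPED
(missing-input `Prop`s), NOT attempted. This is not "finishing BSD". Team n1011, ROUTE-1 (a′):
research route; TOOL theorems only; no definition, no named fact; nothing booked.

## What and why

`Additive/PadicLogImage.lean` computes the image of `padicLog X : E(ℚ_p) →+ ℚ_p`, built from the
tree's LIMIT logarithm `L(P) = lim z(pᵏP)/pᵏ` (`WeierstrassCurve.padicLimitLog`, the device of
`PadicPointsFiltration*` which avoids the formal logarithm).  ROUTE-1's (I2) is about the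
ω-normalised logarithm `log_ω = ∫ω ∘ z`, i.e. the tree's `WeierstrassCurve.padicLogPoint P =
log_W(z(P))` (`FormalGroup.lean`; `log_W = formalLog`, AEC IV.5–IV.6).  The tree compares the two
only in norm (x11b `norm_padicLogPoint_eq_norm_padicLimitLog`); `PadicPointsFiltrationProofs`
records the identification as "neither used nor proved".  This file PROVES it:

* `norm_padicFormalLog_sub_self_le` — `‖log_W(t) − t‖ ≤ 2‖t‖²` for `‖t‖ ≤ p⁻²`
  (`log_W = t + Σ_{n≥2} cₙtⁿ`, `‖cₙ‖ ≤ n`, AEC IV.6.3(a));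
* `padicLogPoint_add_of_isIntegral`, `padicLogPoint_nsmul` — `log_W ∘ z` is additive on `E₁(ℚ_p)`
  for a `p`-INTEGRAL equation (the tree's `padicLogPoint_add_holds` is stated for minimal ones; same
  proof: `z(P + Q) = F(z(P), z(Q))` and `log_W(F(s,t)) = log_W s + log_W t`);
* **`padicLimitLog_eq_padicLogPoint_of_mem` — `L(P) = log_W(z(P))` for `P ∈ E⁽²⁾(ℚ_p)`**
  (`z(pᵏP)/pᵏ − log_W(z(P)) = (z(pᵏP) − log_W z(pᵏP))/pᵏ` has norm `≤ 2 p^{−k} ‖z(P)‖²  → 0`);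
* **`padicLog_eq_padicLogPoint_of_mem`** — hence `padicLog X P = log_W(z(P))` on `E⁽²⁾(ℚ_p)`, and
  `padicLog_eq_padicLogPoint_nsmul_div` — for every `P`, `padicLog X P = log_W(z(N • P))/N`
  (`N = [E(ℚ_p):E⁽²⁾]`): `padicLog` is literally Kato's / Kim's / Castella–JSW's `log_{ω_E}`, so the
  lattices of `PadicLogImage` / `LocalLogImageRat` are `log_ω(E(ℚ_p))`;
* §4 **`padicLogOrd_eq_valuation_padicLog`** — x11b's currency `padicLogOrd W p ι P` (route p2/R1,
  `AnticyclotomicEmbedding`) equals `ord_p (padicLog (W ⊗ ℚ_p) P_ι)` for `P_ι` of infinite order.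

References: [SilvermanAEC2009] IV.5.5, IV.6.3(a), IV.6.4, VII.2.2, VII.6.3.
-/

noncomputable section

open scoped Classical
open Filter PowerSeries Literature.NumberTheory.EllipticCurves
open scoped Topology

namespace Summit.BirchSwinnertonDyer.Rank1Residual.Additive.LocalLog

open WeierstrassCurve

/-! ## §1 `‖log_W(t) − t‖ ≤ 2‖t‖²` near `0` -/

section Local

variable {p : ℕ} [Fact p.Prime] (X : WeierstrassCurve ℚ_[p]) [hX : X.IsIntegral ℤ_[p]] [X.IsElliptic]

omit hX [X.IsElliptic] in
/-- `(n + 2) rⁿ ≤ 2` for `0 ≤ r ≤ 1/4`. [folklore] -/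
private theorem aux_bound' {r : ℝ} (hr0 : 0 ≤ r) (hr : r ≤ 1 / 4) (n : ℕ) :
    ((n : ℝ) + 2) * r ^ n ≤ 2 := by
  induction n with
  | zero => simp
  | succ n ih =>
    have h1 : ((n : ℝ) + 1 + 2) * r ^ (n + 1) = (((n : ℝ) + 3) * r) * r ^ n := by ring
    rw [Nat.cast_succ, h1]
    have h2 : ((n : ℝ) + 3) * r ≤ (n : ℝ) + 2 := by nlinarith
    calc ((n : ℝ) + 3) * r * r ^ n ≤ ((n : ℝ) + 2) * r ^ n :=
          mul_le_mul_of_nonneg_right h2 (pow_nonneg hr0 n)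
      _ ≤ 2 := ih

omit [X.IsElliptic] in
/-- **`‖log_W(t) − t‖_p ≤ 2‖t‖²` for `‖t‖ ≤ p⁻²`** (`p`-integral `W`): `log_W(t) = t + Σ_{n≥2} cₙtⁿ`
with `‖cₙ‖ ≤ n` (AEC IV.6.3(a), tree `norm_coeff_formalLog_le`) and `n rⁿ ≤ 2r²` for `r ≤ 1/4`.
[cite: SilvermanAEC2009, IV.6.3(a) and IV.6.4] -/
theorem norm_padicFormalLog_sub_self_le {t : ℚ_[p]} (ht : ‖t‖ ≤ ((p : ℝ)⁻¹) ^ 2) :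
    ‖X.padicFormalLog t - t‖ ≤ 2 * ‖t‖ ^ 2 := by
  have hp2 : (2 : ℝ) ≤ p := by exact_mod_cast (Fact.out : p.Prime).two_le
  have hr4 : ((p : ℝ)⁻¹) ^ 2 ≤ 1 / 4 := by
    rw [inv_pow, one_div]
    exact inv_anti₀ (by norm_num) (by nlinarith)
  set r := ‖t‖ with hr
  have hr0 : 0 ≤ r := norm_nonneg t
  have hr4' : r ≤ 1 / 4 := ht.trans hr4
  have hr1 : r < 1 := by linarith
  have hsum : Summable fun n : ℕ => coeff n X.formalLog * t ^ n :=
    X.summable_formalLog_of_isIntegral t hr1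
  have hsplit : X.padicFormalLog t = t + ∑' n : ℕ, coeff (n + 2) X.formalLog * t ^ (n + 2) := by
    rw [WeierstrassCurve.padicFormalLog, hsum.tsum_eq_zero_add,
      (summable_nat_add_iff 1 |>.mpr hsum).tsum_eq_zero_add]
    simp only [zero_add, pow_zero, mul_one, pow_one, WeierstrassCurve.coeff_one_formalLog, one_mul]
    rw [show coeff 0 X.formalLog = 0 from by
      rw [PowerSeries.coeff_zero_eq_constantCoeff_apply]; exact X.constantCoeff_formalLog]
    ring_nf
  rw [hsplit, add_sub_cancel_left]
  refine IsUltrametricDist.norm_tsum_le_of_forall_le_of_nonneg (by positivity) fun n => ?_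
  rw [norm_mul, norm_pow]
  calc ‖coeff (n + 2) X.formalLog‖ * r ^ (n + 2) ≤ ((n + 2 : ℕ) : ℝ) * r ^ (n + 2) :=
        mul_le_mul_of_nonneg_right (X.norm_coeff_formalLog_le (n + 2)) (pow_nonneg hr0 _)
    _ = (((n : ℝ) + 2) * r ^ n) * r ^ 2 := by push_cast; ring
    _ ≤ 2 * r ^ 2 := mul_le_mul_of_nonneg_right (aux_bound' hr0 hr4' n) (pow_nonneg hr0 2)

/-! ## §2 `log_W ∘ z` is additive on `E₁(ℚ_p)` (integral equation) -/

omit [X.IsElliptic] in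
/-- **`log_W z(P + Q) = log_W z(P) + log_W z(Q)` on `E₁(ℚ_p)`** for a `p`-INTEGRAL elliptic equation
(the tree's named fact `padicLogPoint_add` is stated for minimal ones; the proof —
`z(P + Q) = F(z(P), z(Q))` (AEC VII.2.2) and `log_W(F(s, t)) = log_W s + log_W t` (AEC IV.6.4(a)) —
only uses integrality). [cite: SilvermanAEC2009, VII.2.2 and IV.6.4(a)] -/
theorem padicLogPoint_add_of_isIntegral {P Q : X.toAffine.Point} (hP : X.IsInReductionKernel P)
    (hQ : X.IsInReductionKernel Q) :
    X.padicLogPoint (P + Q) = X.padicLogPoint P + X.padicLogPoint Q := by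
  simp only [WeierstrassCurve.padicLogPoint]
  rw [← X.padicEval₂_formalGroupLaw_eq_formalParameter_add hP hQ]
  exact X.padicFormalLog_padicEval₂_formalGroupLaw (X.norm_formalParameter_lt_one hP)
    (X.norm_formalParameter_lt_one hQ)

/-- `log_W z(j • P) = j · log_W z(P)` on `E₁(ℚ_p)`. [cite: SilvermanAEC2009, VII.2.2 and IV.6.4(a)] -/
theorem padicLogPoint_nsmul {P : X.toAffine.Point} (hP : X.IsInReductionKernel P) (j : ℕ) :
    X.padicLogPoint (j • P) = j * X.padicLogPoint P := by
  induction j with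
  | zero =>
    rw [zero_nsmul, Nat.cast_zero, zero_mul, WeierstrassCurve.padicLogPoint, X.formalParameter_zero,
      WeierstrassCurve.padicFormalLog]
    have : (fun n : ℕ => coeff n X.formalLog * (0 : ℚ_[p]) ^ n) = fun n =>
        if n = 0 then coeff 0 X.formalLog else 0 := by
      ext n; rcases n with _ | n <;> simp
    rw [this, tsum_ite_eq, PowerSeries.coeff_zero_eq_constantCoeff_apply, X.constantCoeff_formalLog]
  | succ j ih =>
    have hjP : X.IsInReductionKernel (j • P) := by
      have := (X.formalFiltration 0).nsmul_mem (X.mem_formalFiltration_zero_iff.mpr hP) j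
      exact X.mem_formalFiltration_zero_iff.mp this
    rw [succ_nsmul, padicLogPoint_add_of_isIntegral X hjP hP, ih, Nat.cast_succ]
    ring

/-! ## §3 `L = log_W ∘ z` on `E⁽²⁾(ℚ_p)`, hence `padicLog = log_ω` -/

/-- **The limit logarithm is the formal-group logarithm: `L(P) = log_W(z(P))` for `P ∈ E⁽²⁾(ℚ_p)`.**
With `z_k = z(pᵏP)` (`‖z_k‖ = p^{−k}‖z(P)‖`): `z_k/pᵏ → L(P)` (definition of `L`), while
`log_W(z_k)/pᵏ = log_W(z(P))` (additivity) and `‖z_k/pᵏ − log_W(z_k)/pᵏ‖ ≤ 2‖z_k‖² pᵏ → 0`.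
[cite: SilvermanAEC2009, IV.6.4(b) and VII.6.3] -/
theorem padicLimitLog_eq_padicLogPoint_of_mem {P : X.toAffine.Point} (hP : P ∈ X.formalFiltration 2) :
    X.padicLimitLog P = X.padicLogPoint P := by
  have hpR : (0 : ℝ) < p := by exact_mod_cast (Fact.out : p.Prime).pos
  have hp0 : (p : ℚ_[p]) ≠ 0 := Nat.cast_ne_zero.mpr (Fact.out : p.Prime).ne_zero
  have hp1 : (p : ℝ)⁻¹ < 1 := inv_lt_one_of_one_lt₀ (by exact_mod_cast (Fact.out : p.Prime).one_lt)
  have hp0' : (0 : ℝ) ≤ (p : ℝ)⁻¹ := inv_nonneg.mpr hpR.le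
  have hr : ‖X.formalParameter P‖ < (p : ℝ)⁻¹ := X.norm_formalParameter_lt_inv_of_mem le_rfl hP
  have hlim := X.tendsto_approx_padicLimitLog hP.1 hr
  -- the same sequence tends to `log_W z(P)`
  set c := X.padicLogPoint P with hc
  set r := ‖X.formalParameter P‖ with hrdef
  have hr0 : 0 ≤ r := norm_nonneg _
  have hzk : ∀ k : ℕ, ‖X.formalParameter ((p ^ k : ℕ) • P)‖ = ((p : ℝ)⁻¹) ^ k * r :=
    fun k => X.norm_formalParameter_p_pow_nsmul hP.1 hr k
  have hmemk : ∀ k : ℕ, (p ^ k : ℕ) • P ∈ X.formalFiltration 2 := fun k => (X.formalFiltration 2).nsmul_mem hP _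
  have hlogk : ∀ k : ℕ, X.padicLogPoint ((p ^ k : ℕ) • P) = (p : ℚ_[p]) ^ k * c := by
    intro k; rw [padicLogPoint_nsmul X hP.1, Nat.cast_pow]
  -- norm estimate for the difference
  have hest : ∀ k : ℕ, ‖X.formalParameter ((p ^ k : ℕ) • P) / (p : ℚ_[p]) ^ k - c‖ ≤
      2 * (((p : ℝ)⁻¹) ^ k * r ^ 2) := by
    intro k
    set z := X.formalParameter ((p ^ k : ℕ) • P) with hz
    have hzle : ‖z‖ ≤ ((p : ℝ)⁻¹) ^ 2 := (hmemk k).2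
    have h1 : z / (p : ℚ_[p]) ^ k - c = (z - X.padicFormalLog z) / (p : ℚ_[p]) ^ k := by
      have hlog : X.padicFormalLog z = (p : ℚ_[p]) ^ k * c := by
        rw [hz, ← hlogk k]; rfl
      rw [hlog]; field_simp
    rw [h1, norm_div, norm_pow, Padic.norm_p, ← norm_neg, neg_sub]
    have h2 := norm_padicFormalLog_sub_self_le X hzle
    rw [hz] at h2 ⊢
    rw [hzk k] at h2
    have hpk : (0 : ℝ) < ((p : ℝ)⁻¹) ^ k := pow_pos (inv_pos.mpr hpR) k
    rw [div_le_iff₀ hpk]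
    calc ‖X.padicFormalLog (X.formalParameter ((p ^ k : ℕ) • P)) - X.formalParameter ((p ^ k : ℕ) • P)‖
        ≤ 2 * (((p : ℝ)⁻¹) ^ k * r) ^ 2 := h2
      _ = 2 * (((p : ℝ)⁻¹) ^ k * r ^ 2) * ((p : ℝ)⁻¹) ^ k := by ring
  have hlim' : Tendsto (fun k : ℕ => X.formalParameter ((p ^ k : ℕ) • P) / (p : ℚ_[p]) ^ k) atTop (𝓝 c) := by
    rw [tendsto_iff_norm_sub_tendsto_zero]
    have hgeom : Tendsto (fun k : ℕ => 2 * (((p : ℝ)⁻¹) ^ k * r ^ 2)) atTop (𝓝 0) := by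
      have := (tendsto_pow_atTop_nhds_zero_of_lt_one hp0' hp1).mul_const (r ^ 2)
      rw [zero_mul] at this
      simpa using this.const_mul 2
    exact squeeze_zero (fun k => norm_nonneg _) hest hgeom
  exact tendsto_nhds_unique hlim hlim'

/-- **`padicLog X P = log_W(z(P))` for `P ∈ E⁽²⁾(ℚ_p)`**: the logarithm of `PadicLogImage` is the
formal-group logarithm `log_ω = ∫ω ∘ z` there. [cite: SilvermanAEC2009, IV.6.4(b) and VII.6.3] -/
theorem padicLog_eq_padicLogPoint_of_mem {P : X.toAffine.Point} (hP : P ∈ X.formalFiltration 2) :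
    padicLog X P = X.padicLogPoint P := by
  rw [padicLog_apply_of_mem X hP, padicLimitLog_eq_padicLogPoint_of_mem X hP]

/-- **`padicLog = log_ω` on all of `E(ℚ_p)`**: for every `P`, `padicLog X P = log_W(z(N • P))/N` with
`N = [E(ℚ_p) : E⁽²⁾(ℚ_p)]` — Castella's / JSW's `log_{ω_E}(P) = log_{ω_E}(mP)/m`, Kim's `ℤ_p`-linear
`log_ω`. [cite: SilvermanAEC2009, IV.6.4(b) and VII.6.3] -/
theorem padicLog_eq_padicLogPoint_nsmul_div (P : X.toAffine.Point) :
    padicLog X P = X.padicLogPoint ((X.formalFiltration 2).index • P) /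
      ((X.formalFiltration 2).index : ℚ_[p]) := by
  rw [padicLog_apply, padicLimitLog_eq_padicLogPoint_of_mem X ((X.formalFiltration 2).nsmul_index_mem P)]

end Local

/-! ## §4 Bridge to x11b's currency: `padicLogOrd W p ι P = ord_p (padicLog (P_ι))` -/

section RatBridge

open Summit.BirchSwinnertonDyer.Rank1Residual.X11b

variable (W : WeierstrassCurve ℚ) [W.IsElliptic] [W.IsGloballyMinimal] (p : ℕ) [Fact p.Prime]
  {K : Type} [Field K] [NumberField K]

/-- **x11b's `padicLogOrd` IS the valuation of `padicLog`**: for an embedding `ι : K → ℚ_p` and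
`P ∈ E(K)` whose image `P_ι ∈ E(ℚ_p)` has infinite order, `padicLogOrd W p ι P = ord_p (padicLog (W ⊗ ℚ_p) P_ι)`
(both are `ord_p log_ω(m P_ι) − ord_p m` for an admissible multiple `m`; x11b
`padicLogOrd_eq_of_nsmul_mem` with `m = [E(ℚ_p) : E⁽²⁾(ℚ_p)]`). [cite: Castella2018, §2.2 and Thm. 2.3 (arXiv:1704.06608 p. 5)]
[cite: SilvermanAEC2009, IV.6.4 and VII.6.3] -/
theorem padicLogOrd_eq_valuation_padicLog (ι : K →+* ℚ_[p]) (P : (W.baseChange K).toAffine.Point)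
    (hP : ¬ IsOfFinAddOrder (padicPointOf W p ι P)) :
    padicLogOrd W p ι P = (padicLog (W.baseChange ℚ_[p]) (padicPointOf W p ι P)).valuation := by
  set X := W.baseChange ℚ_[p] with hXdef
  set Q := padicPointOf W p ι P with hQ
  set N := (X.formalFiltration 2).index with hN
  have hN0 : N ≠ 0 := index_formalFiltration_two_ne_zero X
  have hNq : (N : ℚ_[p]) ≠ 0 := Nat.cast_ne_zero.mpr hN0
  have hmem2 : N • Q ∈ X.formalFiltration 2 := (X.formalFiltration 2).nsmul_index_mem Q
  have hlogQ : padicLog X Q ≠ 0 := fun h => hP ((padicLog_eq_zero_iff X Q).mp h)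
  have hval : padicLog X Q = X.padicLogPoint (N • Q) / (N : ℚ_[p]) :=
    padicLog_eq_padicLogPoint_nsmul_div X Q
  have hne : X.padicLogPoint (N • Q) ≠ 0 := by
    intro h
    rw [h, zero_div] at hval
    exact hlogQ hval
  rw [padicLogOrd_eq_of_nsmul_mem W p ι P hN0 hmem2.1 hne, hval, div_eq_mul_inv,
    Padic.valuation_mul hne (inv_ne_zero hNq), Padic.valuation_inv, Padic.valuation_natCast]
  ring

end RatBridge

end Summit.BirchSwinnertonDyer.Rank1Residual.Additive.LocalLog

end
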